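import Summits.QuantumAdvantage.QuantumAdvantage.Theorems.MobiusLadderLiouvilleOrthogonalTC0SensLtf
import Summits.QuantumAdvantage.QuantumAdvantage.Theorems.MobiusLadderLiouvilleOrthogonalTC0SpectralLevel
import Summits.QuantumAdvantage.QuantumAdvantage.Theorems.MobiusLadderLiouvilleOrthogonalTC0StubDepthOneLtf
import Summits.QuantumAdvantage.QuantumAdvantage.Theorems.MobiusLadderLiouvilleOrthogonalTC0StubConstSubst3
import Summits.QuantumAdvantage.QuantumAdvantage.Theorems.MobiusLadderLiouvilleOrthogonalTC0FewMajSens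
import Summits.QuantumAdvantage.QuantumAdvantage.Theorems.MobiusLadderLiouvilleOrthogonalTC0StubBlockInfluence
import Summits.QuantumAdvantage.QuantumAdvantage.Theorems.MobiusLadderLiouvilleOrthogonalTC0StubAcInfluence
import Literature.Computability.Complexity.ACFourierTails
import HarnessLib

/-!
# Crux `MobiusLadder.LiouvilleOrthogonalTC0` (stmt-QuantumAdvantage-1393): `λ` is orthogonal to every
polynomial-size `AC⁰` circuit augmented with `O(log n)` majority gates at the bottom (the few-majority rung)

Line `Sketch`, skeleton v7 (lead `prover-line-stmt-QuantumAdvantage-1393-c4-0`). A circuit `C` on the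
`n` binary digits over `tcBasis` (`¬` free, `∧ₖ/∨ₖ/MAJₖ` of any fan-in) of `acDepth ≤ d` and polynomial
size, all of whose MAJORITY gates sit at `acWeight`-depth `≤ 1` (they read literals only, so each is an
integer linear threshold test of the digits) and are at most `c₀ log n` in number, is asymptotically
orthogonal to `λ`. This extends Green's theorem (`AC⁰`, no majority gate; tree `LiouvilleOrthogonalAC0_proof`)
and complements `LtfCombinationPoly` (`≤ n^α` threshold gates under an arbitrary function NOT reading the
raw digits) and the small-fan-in rung (any number of majority gates of fan-in `≤ d log₂ n`).

Proof ("guess the few majority values"): with `T` the set of majority gates, `k = #T`,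
`C(x) = C'_{L(x)}(x)` where `L_a` is the threshold test of the `a`-th majority gate and `C'_v` is `C` with
the majority gates replaced by the constants `v` (`stub_constSubst`, an `acBasis` circuit of no larger
depth/size). For every partition into `m` blocks the block sensitivity of `C` is therefore at most
`Σ_a sens(L_a) + Σ_v sens(C'_v) ≤ k·2ⁿ√m + 2^k·2ⁿ·Φ(d,s)` (`FewMaj.sens_guess_le`; Peres `stub_sensLtf`;
block influence ≤ total influence `stub_blockInfluence`; Tal/Boppana `stub_acInfluence`,
`Φ(d,s) = A^{d+2}B^{d+2}(logM 2s)^d/log 2 = O_d((log s)^d)`), hence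
`W^{≥m}[sgn ∘ C] ≤ 3(k + 2^kΦ/√m)/√m` (`stub_tailOfSens`), which at the spectral level `m = ⌊n^{1/R}⌋₊ + 1`
and with `k ≤ c₀ log n`, `c₀ = 1/(2R)`, is `≪ (log n + (log n)^d) n^{-1/(2R)} → 0`; the single-level
spectral criterion `liouville_orthogonal_of_tailWeight_level` (Bourgain + Green §2) finishes.

This file (fan-in `≥ 3` version of `…FewMajSens.lean`: only the GENUINE majority gates `MAJₖ`, `k ≥ 3`,
are constrained and guessed — `MAJ₀ = ∧₀`, `MAJ₁ = ∧₁`, `MAJ₂ = ∨₂` are `AC⁰` gates in the extensional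
gate model, `stub_constSubst3`): `FewMaj3.sens_fewMaj_le`, `FewMaj3.tailWeight_fewMaj_le` (registered stub
`stub_fewMajTail3`), on top of the generic accounting `FewMaj.sens_guess_le`; the rung
`liouville_orthogonal_fewMaj` (registered stub `stub_fewMaj`) is in `…FewMaj.lean`.
-/

set_option linter.dupNamespace false -- D-0017: single-problem summit ⇒ `QuantumAdvantage.QuantumAdvantage` by design

noncomputable section

namespace Summit.QuantumAdvantage.QuantumAdvantage.Theorems.LiouvilleOrthogonalTC0

open Filter Finset Topology
open Literature.Computability.Complexity
open Literature.Computability.Complexity.GateList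
open Literature.Computability.Complexity.LowDegree (tailWeight)
open Literature.Probability.RandomGraphs.LowDegree (sgn)
open Literature.NumberTheory.Sieve


namespace FewMaj3

variable {n m : ℕ}

/-! ### Majority gates: the test `fn = MAJ_arity` -/

/-- A gate is a majority gate of fan-in `≥ 3` iff it has arity `≥ 3` and is the majority gate of its
own arity. -/
theorem fn_eq_bigMaj_iff {ι : Type*} (g : Gate ι) :
    (∃ k, 3 ≤ k ∧ g.fn = GateFn.maj k) ↔ 3 ≤ g.arity ∧ g.fn = GateFn.maj g.arity := by
  constructor
  · rintro ⟨k, hk3, hk⟩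
    have harity : g.arity = k := by
      have := congrArg Sigma.fst hk
      simpa [Gate.fn, GateFn.maj] using this
    rw [harity]; exact ⟨hk3, hk⟩
  · exact fun h => ⟨g.arity, h.1, h.2⟩

/-! ### The block sensitivity of a circuit with few bottom majority gates -/

/-- **Block sensitivity of a `tcBasis` circuit all of whose majority gates sit at the bottom.** With
`T` the set of majority gates (all at `acWeight`-depth `≤ 1`, hence integer threshold tests of the
inputs) and `k = #T`: for every partition into `m` blocks, the number of pairs (point, sensitive
block) is `≤ k · 2ⁿ √m + 2^k · 2ⁿ · Φ(d, s)` — guess the `k` majority values (`stub_constSubst`),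
the tests cost `2ⁿ√m` each (`stub_sensLtf`), each of the `2^k` guessed `AC⁰` circuits costs
`2ⁿ Φ(d,s)` (`stub_blockInfluence`, `stub_acInfluence`). -/
theorem sens_fewMaj_le (C : Circuit (Fin n)) (hB : C.IsOver tcBasis) {d s : ℕ} (hd : C.acDepth ≤ d)
    (hs : C.size ≤ s) (h1 : 1 ≤ s)
    (hMd : ∀ (j : ℕ) (hj : j < C.gates.length), (∃ k, 3 ≤ k ∧ (C.gates[j]).fn = GateFn.maj k) →
      (wdepths acWeight C.gates).getD j 0 ≤ 1)
    (π : Fin n → Fin m) :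
    ∑ x : Fin n → Bool, ((univ.filter fun j : Fin m =>
        C.eval x ≠ C.eval (fun i => xor (x i) (decide (π i = j)))).card : ℝ)
      ≤ ((univ.filter fun j : Fin C.gates.length =>
            3 ≤ (C.gates[j]).arity ∧ (C.gates[j]).fn = GateFn.maj (C.gates[j]).arity).card : ℝ) * (2 ^ n * Real.sqrt m) +
        2 ^ ((univ.filter fun j : Fin C.gates.length =>
            3 ≤ (C.gates[j]).arity ∧ (C.gates[j]).fn = GateFn.maj (C.gates[j]).arity).card) *
          (2 ^ n * ((ACForm.cA : ℝ) ^ (d + 2) * (ACForm.cB : ℝ) ^ (d + 2) *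
            (ACForm.logM (2 * s) : ℝ) ^ d / Real.log 2)) := by
  set T : Finset (Fin C.gates.length) :=
    univ.filter fun j : Fin C.gates.length => 3 ≤ (C.gates[j]).arity ∧ (C.gates[j]).fn = GateFn.maj (C.gates[j]).arity with hT
  set k : ℕ := T.card with hk
  set Φ : ℝ := (ACForm.cA : ℝ) ^ (d + 2) * (ACForm.cB : ℝ) ^ (d + 2) *
    (ACForm.logM (2 * s) : ℝ) ^ d / Real.log 2 with hΦ
  -- enumerate the majority gates
  set e : Fin k ≃ {j // j ∈ T} := T.equivFin.symm with he
  -- the tests: the values of the majority gates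
  set L : Fin k → (Fin n → Bool) → Bool := fun a x => (vals C.gates x).getD ((e a).1 : ℕ) false with hL
  have hmemT : ∀ {j : Fin C.gates.length}, j ∈ T ↔ 3 ≤ (C.gates[j]).arity ∧ (C.gates[j]).fn = GateFn.maj (C.gates[j]).arity := by
    intro j; simp [hT]
  -- each test is an integer linear threshold function
  have hLtf : ∀ a : Fin k, ∃ (w : Fin n → ℤ) (θ : ℤ), ∀ x : Fin n → Bool,
      L a x = decide (θ ≤ ∑ i, w i * (if x i then (1 : ℤ) else 0)) := by
    intro a
    set j : Fin C.gates.length := (e a).1 with hj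
    have hjT : j ∈ T := (e a).2
    have hmaj : ∃ k', 3 ≤ k' ∧ (C.gates[(j : ℕ)]).fn = GateFn.maj k' := ⟨_, (hmemT.1 hjT).1, (hmemT.1 hjT).2⟩
    have hdep : wireDepthOf (wdepths acWeight C.gates) (.inr (j : ℕ) : Fin n ⊕ ℕ) ≤ 1 := by
      rw [wireDepthOf_inr]; exact hMd j j.2 hmaj
    have hOK : OutOK C.gates.length (.inr (j : ℕ) : Fin n ⊕ ℕ) := fun m' h => by cases h; exact j.2
    obtain ⟨w, θ, hw⟩ := (DepthOneLtf.wire_invariant C.gates (wf_gates C) hB _ hOK).2 hdep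
    refine ⟨w, θ, fun x => ?_⟩
    have := hw x
    rw [wireOf_inr] at this
    simpa only [hL] using this
  -- the guesses, as functions of the gate position
  let vext : (Fin k → Bool) → ℕ → Bool := fun v j =>
    if hj : j < C.gates.length then
      (if hjT : (⟨j, hj⟩ : Fin C.gates.length) ∈ T then v (T.equivFin ⟨⟨j, hj⟩, hjT⟩) else false)
    else false
  choose C' hC' using fun v : Fin k → Bool => stub_constSubst3 C hB (vext v)
  -- `C(x) = C'_{L(x)}(x)`
  have hF : ∀ x, C.eval x = (C' (fun a => L a x)).eval x := by
    intro x
    refine ((hC' (fun a => L a x)).2.2.2 x fun j hj hmaj => ?_).symm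
    have hjT : (⟨j, hj⟩ : Fin C.gates.length) ∈ T := hmemT.2 ((fn_eq_bigMaj_iff _).1 hmaj)
    show vext (fun a => L a x) j = _
    simp only [vext, dif_pos hj, dif_pos hjT, hL]
    congr 1
    have : e (T.equivFin ⟨⟨j, hj⟩, hjT⟩) = ⟨⟨j, hj⟩, hjT⟩ := by
      rw [he]; exact Equiv.symm_apply_apply _ _
    rw [this]
  -- the accounting
  have hacc := FewMaj.sens_guess_le (fun x => C.eval x) L (fun v x => (C' v).eval x) hF π
  refine hacc.trans (add_le_add ?_ ?_)
  · -- the tests: `k · 2ⁿ√m`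
    calc ∑ a : Fin k, ∑ x : Fin n → Bool, ((univ.filter fun j : Fin m =>
            L a x ≠ L a (fun i => xor (x i) (decide (π i = j)))).card : ℝ)
        ≤ ∑ _a : Fin k, 2 ^ n * Real.sqrt m := by
          refine Finset.sum_le_sum fun a _ => ?_
          obtain ⟨w, θ, hw⟩ := hLtf a
          simp only [hw]
          exact stub_sensLtf w θ π
      _ = (k : ℝ) * (2 ^ n * Real.sqrt m) := by
          rw [Finset.sum_const, Finset.card_univ, Fintype.card_fin, nsmul_eq_mul]
  · -- the guessed `AC⁰` circuits: `2^k · 2ⁿ Φ`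
    calc ∑ v : Fin k → Bool, ∑ x : Fin n → Bool, ((univ.filter fun j : Fin m =>
            (C' v).eval x ≠ (C' v).eval (fun i => xor (x i) (decide (π i = j)))).card : ℝ)
        ≤ ∑ _v : Fin k → Bool, 2 ^ n * Φ := by
          refine Finset.sum_le_sum fun v _ => ?_
          obtain ⟨hB', hd', hs', -⟩ := hC' v
          exact (stub_blockInfluence (fun x => (C' v).eval x) π).trans
            (stub_acInfluence (C' v) hB' (hd'.trans hd) (hs'.trans hs) h1)
      _ = 2 ^ k * (2 ^ n * Φ) := by
          rw [Finset.sum_const, Finset.card_univ, Fintype.card_fun, Fintype.card_bool, Fintype.card_fin,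
            nsmul_eq_mul, Nat.cast_pow, Nat.cast_ofNat]

/-- **Fourier tail of a circuit with `k` bottom majority gates**:
`W^{≥ m}[sgn ∘ C] ≤ 3 (k + 2^k Φ(d,s)/√m)/√m` for `m ≥ 10`. -/
theorem tailWeight_fewMaj_le (hm : 10 ≤ m) (C : Circuit (Fin n)) (hB : C.IsOver tcBasis) {d s : ℕ}
    (hd : C.acDepth ≤ d) (hs : C.size ≤ s) (h1 : 1 ≤ s)
    (hMd : ∀ (j : ℕ) (hj : j < C.gates.length), (∃ k, 3 ≤ k ∧ (C.gates[j]).fn = GateFn.maj k) →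
      (wdepths acWeight C.gates).getD j 0 ≤ 1) :
    tailWeight (fun x : Fin n → Bool => sgn (C.eval x)) m
      ≤ 3 * (((univ.filter fun j : Fin C.gates.length =>
            3 ≤ (C.gates[j]).arity ∧ (C.gates[j]).fn = GateFn.maj (C.gates[j]).arity).card : ℝ) +
          2 ^ ((univ.filter fun j : Fin C.gates.length =>
            3 ≤ (C.gates[j]).arity ∧ (C.gates[j]).fn = GateFn.maj (C.gates[j]).arity).card) *
            ((ACForm.cA : ℝ) ^ (d + 2) * (ACForm.cB : ℝ) ^ (d + 2) *
              (ACForm.logM (2 * s) : ℝ) ^ d / Real.log 2) / Real.sqrt m) / Real.sqrt m := by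
  have hmpos : (0 : ℝ) < m := Nat.cast_pos.2 (by omega)
  have hs0 : 0 < Real.sqrt m := Real.sqrt_pos.2 hmpos
  refine stub_tailOfSens hm (fun x : Fin n → Bool => C.eval x) (fun π => ?_)
  have h := sens_fewMaj_le C hB hd hs h1 hMd π
  refine h.trans (le_of_eq ?_)
  field_simp

end FewMaj3



/-- **Registered stub `stub_fewMajTail3`** (line `Sketch`, v7, lead c4): verbatim `FewMaj3.tailWeight_fewMaj_le`. -/
theorem stub_fewMajTail3 {n m : ℕ} (hm : 10 ≤ m) (C : Circuit (Fin n)) (hB : C.IsOver tcBasis) {d s : ℕ} (hd : C.acDepth ≤ d) (hs : C.size ≤ s) (h1 : 1 ≤ s) (hMd : ∀ (j : ℕ) (hj : j < C.gates.length), (∃ k, 3 ≤ k ∧ (C.gates[j]).fn = GateFn.maj k) → (wdepths acWeight C.gates).getD j 0 ≤ 1) : tailWeight (fun x : Fin n → Bool => sgn (C.eval x)) m ≤ 3 * (((univ.filter fun j : Fin C.gates.length => 3 ≤ (C.gates[j]).arity ∧ (C.gates[j]).fn = GateFn.maj (C.gates[j]).arity).card : ℝ) + 2 ^ ((univ.filter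 fun j : Fin C.gates.length => 3 ≤ (C.gates[j]).arity ∧ (C.gates[j]).fn = GateFn.maj (C.gates[j]).arity).card) * ((ACForm.cA : ℝ) ^ (d + 2) * (ACForm.cB : ℝ) ^ (d + 2) * (ACForm.logM (2 * s) : ℝ) ^ d / Real.log 2) / Real.sqrt m) / Real.sqrt m :=
  FewMaj3.tailWeight_fewMaj_le hm C hB hd hs h1 hMd

end Summit.QuantumAdvantage.QuantumAdvantage.Theorems.LiouvilleOrthogonalTC0

end
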